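import Summits.Ventures.CertifiedManyBodySolver.Downfold.RouterScoreMoPredCut

/-!
# Router-word score, part 4d: the VSET TRANCHE of a material id and its RECEIPT CLASS — which worded rows get a
# score-2 receipt, which are pooled into the R tally of record, and which tick the MO-PRED-1 first-word tally

Venture CertifiedManyBodySolver, cell `pub/hubbard-downfold`, seat hubbard-downfold-score-2 (session g24, 2026-08-31);
namespace `Summit.Ventures.CertifiedManyBodySolver.Downfold.RouterScore` (continues `RouterScoreMoPredCut.lean` p778026:
`WordRow`, `fwTally`, `clauseA`). Finite, PROVED bookkeeping statements; nothing here is physics.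

The layer of record it mirrors: score-2's `router/router_score.py::tranche_of` (VSET §7 / R13 / R15 / R16 / R19b / R20 / R-cv:
ids 1–32 and 50 = the v1 CALIBRATION set (the R tally of record); 33–52 except 50 = the HOLD-OUT set (blind until the close, no
receipt by rule — #450 M45 UPt₃); 53–71 v2 · 72–106 v3 · 107–139 v4 · 140–184 v5 · 185–190 v6 · 191–205 v7 = CLOSED tranches with
their own tables (a worded row gets a PREVIEW receipt, is never pooled with R or v8 and never ticks MO-PRED-1); 206–599 v8 = the one
OPEN tranche (upper end PROVISIONAL, widened by dated PREREG lines before any id beyond it is worded; receipts of record AND the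
MO-PRED-1 out-of-sample ledger: a v8 material's FIRST word ticks the clause-(A) tally); beyond = UNASSIGNED (listed and previewed,
never scored nor pooled — «a future tranche can never be silently pooled into an earlier table»).

* §1 `Tranche`, `trancheOf` (the id map above, `v8Upper` = 599) with the range lemmas `trancheOf_eq_v8_iff`,
  `trancheOf_eq_holdOut_iff`, `trancheOf_eq_calibration_iff` (M50 = LSCO x 0.30 is calibration INSIDE the hold-out id range).
* §2 `ReceiptClass` = {pooledR, blind, preview, mopred, none} and `receiptClassOf : Tranche → ReceiptClass`; the three Booleans every
  receipt line states — `receipted`, `pooledWithR`, `mopredCounts` — as functions of the class; PROVED: `mopredCounts t ↔ t = v8`,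
  `pooledWithR t ↔ t = calibration`, `receipted t ↔ t ∉ {holdOut, unassigned}`, and the PREVIEW class is exactly v2 … v7
  (`preview_iff`).
* §3 The bridge to part 4c: `rowOf m first twin : WordRow` sets `counted := mopredCounts (trancheOf m) ∧ ¬twin`; PROVED: such a row
  ticks iff it is a first word of a non-twin v8 id (`rowOf_ticks_iff`), so appending any non-v8 row leaves `fwTally` — hence clause (A)
  and the cut — unchanged (`fwTally_append_rowOf_of_ne_v8`, `clauseA_append_rowOf_of_ne_v8`).
* §4 The instance of record (2026-08-31): the MO-PRED-1.24 ledger = WORDS rows 899–932 since the 1.23 cut 15:18:12Z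
  (`rows124`, ids and first-word flags as `mopred_tally.py` prints them; the v4 U-door rows M118 / M117 / M119, the hold-out M45, the
  tetradymite P columns and the v5 / v7 package rows of the night included) ⇒ tally 8 = M222 · M276 · M289 · M285 · M284 · M210 ·
  M211 · M209, clause (A) NOT fired, 7 to go (`mopred124_tally`); tonight's lettered object v7 M193 YPtBi (block61) is a PREVIEW row:
  appending it, first word or not, keeps the tally at 8 (`m193_preview`, `mopred124_after_yptbi`).

WHAT THIS IS NOT: not the id keeper's list (deputy-2's ids_v8.txt is the source of which ids exist), not a ruling on tranche
boundaries (the lead's VSET letters are) and not a score; it is the classification every receipt line of the seat states in words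
(«v7 ⇒ PREVIEW receipt, never pooled with R / v8, no MO-PRED tick»; «hold-out ⇒ no receipt by rule»), so those clauses are mechanical.
-/

namespace Summit.Ventures.CertifiedManyBodySolver.Downfold

namespace RouterScore

/-! ## §1 The tranche of a material id -/

/-- The VSET tranches as `router_score.py::tranche_of` names them. [folklore] -/
inductive Tranche
  | calibration
  | holdOut
  | v2
  | v3
  | v4
  | v5
  | v6
  | v7
  | v8
  | unassigned
  deriving DecidableEq, Repr

/-- the PROVISIONAL upper end of the open v8 tranche (`V8_RANGE = (206, 599)` since 2026-08-30T00:5xZ; widened by a dated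
PREREG line before any id beyond it is worded). [folklore] -/
def v8Upper : ℕ := 599

/-- the tranche of material id `n` (M`n`; a letter suffix such as M11b / M39b is stripped before the lookup, as in the tool):
1–32 and 50 calibration · 33–52 except 50 hold-out · 53–71 v2 · 72–106 v3 · 107–139 v4 · 140–184 v5 · 185–190 v6 · 191–205 v7 ·
206–`v8Upper` v8 · beyond unassigned. [folklore] -/
def trancheOf (n : ℕ) : Tranche :=
  if v8Upper < n then .unassigned
  else if 206 ≤ n then .v8
  else if 191 ≤ n then .v7
  else if 185 ≤ n then .v6
  else if 140 ≤ n then .v5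
  else if 107 ≤ n then .v4
  else if 72 ≤ n then .v3
  else if 53 ≤ n then .v2
  else if 33 ≤ n ∧ n ≠ 50 then .holdOut
  else .calibration

/-- the v8 tranche is exactly the id range 206 … `v8Upper`. [folklore] -/
theorem trancheOf_eq_v8_iff (n : ℕ) : trancheOf n = .v8 ↔ 206 ≤ n ∧ n ≤ v8Upper := by
  unfold trancheOf v8Upper
  constructor
  · intro h; split_ifs at h; omega
  · intro h; split_ifs <;> first | rfl | (exfalso; omega)

/-- the hold-out tranche is exactly 33 … 52 without 50. [folklore] -/
theorem trancheOf_eq_holdOut_iff (n : ℕ) : trancheOf n = .holdOut ↔ 33 ≤ n ∧ n ≤ 52 ∧ n ≠ 50 := by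
  unfold trancheOf v8Upper
  constructor
  · intro h; split_ifs at h; omega
  · intro h; split_ifs <;> first | rfl | (exfalso; omega)

/-- the calibration set is exactly the ids ≤ 32 together with 50 (LSCO x 0.30, on the nine §14 maps). [folklore] -/
theorem trancheOf_eq_calibration_iff (n : ℕ) : trancheOf n = .calibration ↔ n ≤ 32 ∨ n = 50 := by
  unfold trancheOf v8Upper
  constructor
  · intro h; split_ifs at h; omega
  · intro h; split_ifs <;> first | rfl | (exfalso; omega)

/-- ids beyond the provisional v8 upper end are unassigned (previewed, never scored): the widening must precede the word. [folklore] -/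
theorem trancheOf_eq_unassigned_iff (n : ℕ) : trancheOf n = .unassigned ↔ v8Upper < n := by
  unfold trancheOf v8Upper
  constructor
  · intro h; split_ifs at h; omega
  · intro h; rw [if_pos h]

/-! ## §2 The receipt class of a tranche -/

/-- What the seat does with a worded row of a given tranche: `pooledR` = receipt + pooled into the R tally of record (v1
calibration); `blind` = hold-out, NO receipt until the unblinding at the close; `preview` = receipt into the tranche's own
table, never pooled with R / v8, no MO-PRED tick (v2 … v7); `mopred` = receipt of record + the material's FIRST word ticks the
MO-PRED-1 clause-(A) tally (v8); `none` = unassigned, listed and previewed only. [folklore] -/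
inductive ReceiptClass
  | pooledR
  | blind
  | preview
  | mopred
  | none
  deriving DecidableEq, Repr

/-- the receipt class of each tranche. [folklore] -/
def receiptClassOf : Tranche → ReceiptClass
  | .calibration => .pooledR
  | .holdOut => .blind
  | .v2 | .v3 | .v4 | .v5 | .v6 | .v7 => .preview
  | .v8 => .mopred
  | .unassigned => .none

/-- a worded row of this tranche gets a score-2 receipt line on its STAMP. [folklore] -/
def Tranche.receipted (t : Tranche) : Bool :=
  match receiptClassOf t with
  | .blind | .none => false
  | _ => true

/-- the row's verdict is pooled into the R tally of record (the v1 calibration table). [folklore] -/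
def Tranche.pooledWithR (t : Tranche) : Bool := decide (receiptClassOf t = .pooledR)

/-- the material's first word ticks the MO-PRED-1 tally (`WordRow.counted` of part 4c, twins aside). [folklore] -/
def Tranche.mopredCounts (t : Tranche) : Bool := decide (receiptClassOf t = .mopred)

/-- the PREVIEW predicate as the receipt lines spell it: receipted, not pooled with R, no MO-PRED tick. [folklore] -/
def Tranche.preview (t : Tranche) : Bool := t.receipted && !t.pooledWithR && !t.mopredCounts

/-- only v8 ticks MO-PRED-1. [folklore] -/
theorem mopredCounts_iff (t : Tranche) : t.mopredCounts = true ↔ t = .v8 := by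
  cases t <;> decide

/-- only the calibration set is pooled into R. [folklore] -/
theorem pooledWithR_iff (t : Tranche) : t.pooledWithR = true ↔ t = .calibration := by
  cases t <;> decide

/-- every tranche but the hold-out and the unassigned ids is receipted. [folklore] -/
theorem receipted_iff (t : Tranche) : t.receipted = true ↔ t ≠ .holdOut ∧ t ≠ .unassigned := by
  cases t <;> decide

/-- the PREVIEW class is exactly the closed tranches v2 … v7 (= `receiptClassOf t = preview`). [folklore] -/
theorem preview_iff (t : Tranche) :
    t.preview = true ↔ receiptClassOf t = .preview := by
  cases t <;> decide

/-- … spelled as a list of tranches. [folklore] -/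
theorem preview_iff_mem (t : Tranche) :
    t.preview = true ↔ t ∈ [Tranche.v2, .v3, .v4, .v5, .v6, .v7] := by
  cases t <;> decide

/-- a hold-out row gets no receipt (the #450 M45 UPt₃ rule). [folklore] -/
theorem holdOut_not_receipted : Tranche.holdOut.receipted = false := by decide

/-- a preview row never ticks MO-PRED-1 and is never pooled with R. [folklore] -/
theorem preview_no_tick_no_pool {t : Tranche} (h : t.preview = true) :
    t.mopredCounts = false ∧ t.pooledWithR = false := by
  revert h; cases t <;> decide

/-! ## §3 The bridge to the MO-PRED-1 tally of part 4c -/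

/-- the `WordRow` of a WORDS row from its material id: `counted` = the id's tranche ticks MO-PRED-1 and the row is not an
isotope-twin row. [folklore] -/
def rowOf (m : ℕ) (first twin : Bool) : WordRow := ⟨m, first, (trancheOf m).mopredCounts && !twin⟩

/-- such a row ticks iff it is the first word of a non-twin v8 material. [folklore] -/
theorem rowOf_ticks_iff (m : ℕ) (first twin : Bool) :
    (rowOf m first twin).ticks = true ↔ first = true ∧ trancheOf m = .v8 ∧ twin = false := by
  rw [← mopredCounts_iff]
  cases first <;> cases twin <;> simp [rowOf, WordRow.ticks]

/-- a row of a non-v8 id never ticks, first word or not. [folklore] -/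
theorem rowOf_ticks_of_ne_v8 {m : ℕ} (h : trancheOf m ≠ .v8) (first twin : Bool) :
    (rowOf m first twin).ticks = false := by
  cases ht : (rowOf m first twin).ticks
  · rfl
  · exact absurd ((rowOf_ticks_iff m first twin).mp ht).2.1 h

/-- appending a non-v8 row (a v2 … v7 PREVIEW word, a hold-out word, a calibration re-issue) leaves the tally unchanged. [folklore] -/
theorem fwTally_append_rowOf_of_ne_v8 (evs : List WordRow) {m : ℕ} (h : trancheOf m ≠ .v8) (first twin : Bool) :
    fwTally (evs ++ [rowOf m first twin]) = fwTally evs := by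
  rw [fwTally_append_singleton, rowOf_ticks_of_ne_v8 h]; simp

/-- … hence clause (A) reads the same after it. [folklore] -/
theorem clauseA_append_rowOf_of_ne_v8 (k : ℕ) (evs : List WordRow) {m : ℕ} (h : trancheOf m ≠ .v8) (first twin : Bool) :
    clauseA k (evs ++ [rowOf m first twin]) = clauseA k evs := by
  simp [clauseA, fwTally_append_rowOf_of_ne_v8 evs h]

/-- a v8 first word of a non-twin material advances the tally by exactly one. [folklore] -/
theorem fwTally_append_rowOf_v8_first (evs : List WordRow) {m : ℕ} (h : trancheOf m = .v8) :
    fwTally (evs ++ [rowOf m true false]) = fwTally evs + 1 := by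
  rw [fwTally_append_singleton, (rowOf_ticks_iff m true false).mpr ⟨rfl, h, rfl⟩]; simp

/-! ## §4 The instance of record: the MO-PRED-1.24 ledger on 2026-08-31 and tonight's v7 object -/

/-- WORDS rows 899–932 (every row after the 1.23 cut 2026-08-30T15:18:12Z, in file order) as (id, first word of record?, twin
row?): M222 ×3 (first @0) · M118 · M276 ×2 · M45 ×2 (hold-out) · M289 ×2 · M117 · M119 ×3 · M285 · M284 · M210 · M211 · M209 ·
M324 @2.3 / M326 @4 (further P columns) · M170 · M204 · M176 · M177 · M196 · M154 · M168 · M169 (Th₄D₁₅, isotope twin) ·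
M166 ×2 · M152 · M168 @2 (further column) · M153. [folklore] -/
def rows124 : List WordRow :=
  [rowOf 222 true false, rowOf 222 false false, rowOf 222 false false, rowOf 118 true false, rowOf 276 true false,
   rowOf 276 false false, rowOf 45 true false, rowOf 45 false false, rowOf 289 true false, rowOf 289 false false,
   rowOf 117 true false, rowOf 119 true false, rowOf 119 false false, rowOf 119 false false, rowOf 285 true false,
   rowOf 284 true false, rowOf 210 true false, rowOf 211 true false, rowOf 209 true false, rowOf 324 false false,
   rowOf 326 false false, rowOf 170 true false, rowOf 204 true false, rowOf 176 true false, rowOf 177 true false,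
   rowOf 196 true false, rowOf 154 true false, rowOf 168 true false, rowOf 169 true true, rowOf 166 true false,
   rowOf 166 false false, rowOf 152 true false, rowOf 168 false false, rowOf 153 true false]

/-- the 1.24 ledger at 2026-08-31T06:00Z: 34 rows, tally 8 (M222 · M276 · M289 · M285 · M284 · M210 · M211 · M209), clause (A)
with k = 15 NOT fired — seven more v8 first words to go (`mopred_tally.py` prints «COUNTED 8»). [folklore] -/
theorem mopred124_tally : rows124.length = 34 ∧ fwTally rows124 = 8 ∧ clauseA 15 rows124 = false ∧ 15 - fwTally rows124 = 7 := by
  decide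

/-- the ticking rows of the ledger are exactly the eight v8 first words, in WORDS order. [folklore] -/
theorem mopred124_tickers : (rows124.filter WordRow.ticks).map WordRow.mat = [222, 276, 289, 285, 284, 210, 211, 209] := by
  decide

/-- tonight's lettered object (lead g40 R-abs; score-2 block61): M193 YPtBi is a v7 id ⇒ PREVIEW class — receipted, not pooled
with R, no MO-PRED tick. [folklore] -/
theorem m193_preview : trancheOf 193 = .v7 ∧ (trancheOf 193).preview = true ∧ (trancheOf 193).receipted = true ∧
    (trancheOf 193).mopredCounts = false ∧ (trancheOf 193).pooledWithR = false := by
  decide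

/-- … so its word, when it lands (first word of the material or a re-issue), leaves the 1.24 tally at 8. [folklore] -/
theorem mopred124_after_yptbi (first : Bool) : fwTally (rows124 ++ [rowOf 193 first false]) = 8 := by
  rw [fwTally_append_rowOf_of_ne_v8 rows124 (by decide) first false]; exact mopred124_tally.2.1

/-- the other receipt classes met in the ledger: M45 UPt₃ hold-out (no receipt, #450), M118 / M117 / M119 v4 and M152 / M153 /
M166 / M168 / M170 v5 and M196 / M204 v7 previews, M50 calibration (the exception inside 33–52), M222 / M209 v8. [folklore] -/
theorem ledger124_classes : trancheOf 45 = .holdOut ∧ (trancheOf 45).receipted = false ∧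
    trancheOf 118 = .v4 ∧ trancheOf 117 = .v4 ∧ trancheOf 119 = .v4 ∧ trancheOf 152 = .v5 ∧ trancheOf 153 = .v5 ∧
    trancheOf 166 = .v5 ∧ trancheOf 168 = .v5 ∧ trancheOf 170 = .v5 ∧ trancheOf 196 = .v7 ∧ trancheOf 204 = .v7 ∧
    trancheOf 50 = .calibration ∧ trancheOf 13 = .calibration ∧ trancheOf 222 = .v8 ∧ trancheOf 209 = .v8 ∧
    trancheOf 600 = .unassigned := by
  decide

end RouterScore

end Summit.Ventures.CertifiedManyBodySolver.Downfold
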